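/-
Copyright: the b2b-balaban T⁴-continuum CRUX team, row NE7b OWNER lineage `t4-ne7b-p1` (gen 126). Project licence.
-/
import Summits.QuantumFields.BalabanUV.T4Continuum.Spine.NE7b.SupZdCouplingShiftColumn
import Mathlib.Order.ConditionallyCompleteLattice.Indexed

/-!
# UNIQUENESS OF BOUNDED SOLUTIONS TRANSFERS ACROSS COUPLINGS: on `ℤ^d`, if at coupling `a` the operator `H_{V,a} + K` has bounded
# solutions for bounded sources with an `ℓ^∞` bound `C_G` ((213)'s `‖G_K‖ ≤ 2C₀`) and bounded solutions are unique ((237) (U)), then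
# at EVERY coupling `a′` with `|a′ − a|·C_G < 1` bounded solutions of `(H_{V,a′} + K)u = f` are unique — `H_{V,a′} − H_{V,a} = (a′−a)Π` with
# `‖Π‖_{ℓ^∞} ≤ 1`, so a bounded null solution at `a′` is `G(−(a′−a)Πw)` at `a` and its sup contracts; the (U)-input of (258)–(260) at the
# shifted coupling, from data at the reference coupling with an EXPLICIT window (row NE7b, node U5c; (258) BY NAME for the import
# closure; [folklore])

Cell `pub-balaban`, sub-cell `t4`, spine estimate NE7b (`T4WeightBudget.RelWeightBound`; the cell's OWN estimate — NOT PRINTED in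
[Bałaban 1983–89], NOT PROVED).  Crux-route work under `Spine/NE7b/` by the row OWNER (`t4-ne7b-p1` gen 126, file (261)) under FREEZE
(0)'s crux-prover clause, on § [NE7bP1-G125-HANDOFF] NEXT (3)(a) (the a-uniformity audit: (258)–(260) take the column, (U) and the inverses
AT the shifted coupling as inputs; this file and (262) produce them from the reference coupling); NOTHING of Bałaban's is named as a Lean
object, valued or asserted; no `T4Continuum/Support` leaf typed; no `def`, no notation (the solution operator at `a` enters through the
displayed existence clause (E) and (237)'s (U)); zero `sorry`.  Imports (BY NAME): the OWNER's (258) `…SupZdCouplingShiftColumn` (import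
closure: (189) `summable_kernel_row`, (27) `mem_B` ∕ `sum_B_const`), Mathlib's indexed conditionally complete lattice API (`le_ciSup`,
`ciSup_le`, the sup of `|w|` over `ℤ^d`).

WHY (located).  (258) §2, (259), (260) need uniqueness of bounded solutions at the shifted coupling `a′`.  By name it is (237) (U) at `a′`,
whose smallness conditions on `K` involve the opaque constants `C₀(a′), C_P(a′), δ₀(a′)`.  From the reference coupling instead: a bounded
`w` with `(H_{V,a′} + K)w = 0` solves `(H_{V,a} + K)w = −(a′−a)Πw`, a bounded source of sup `≤ |a′−a|·sup|w|` (block means do not exceed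
the sup); by (E) + (U) at `a`, `w` IS the solution operator applied to that source, so `sup|w| ≤ C_G|a′−a|·sup|w|`, and `C_G|a′−a| < 1`
forces `w = 0`.  The window `|a′ − a| < 1∕C_G` is explicit in the reference constants; (255)'s couplings `c_k ∈ (a(1 − (n+1)^{−d}), a]` lie
in it as soon as `a(n+1)^{−d}C_G < 1`, and finitely many transfers of width `1∕(2C_G)`-type cover the rest ((262) records the chaining).

WHAT IS PROVED ([folklore]; every mesh `n`, ANY `a, a′ : ℝ`, ANY `V`, kernel `|K(p,q)| ≤ εe^{−γ|p−q|₁}`):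
* §1 `blockMean_abs_le_of_forall` (`|(n+1)^{−d}Σ_{B b}w| ≤ s` if `|w| ≤ s`), `sub_solves` (differences of solutions solve the difference
  equation — the kernel rows converge for bounded functions).
* §2 THE END **`uniqueness_transfer`** ((E) with constant `C_G` and (U) at `a`, `|a′−a|·C_G < 1` ⟹ (U) at `a′`, in (237)'s shape verbatim).
* §3 toy.

HONEST (what this is NOT).  An `ℓ^∞` contraction; (E) and (U) at the reference coupling are INPUTS ((213)∕(237)); only uniqueness is
transferred here (existence of the columns at `a′` is (262)); scalar skeleton ((A3), NC-NE7b-α UNRULED); nothing of the torus; nothing of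
the covariant propagators of [B4]–[B6]; nothing of Bałaban's asserted.  BY-NAME EFFECT ON THE WALL: NONE.  NE7b NOT PRINTED ∕ NOT PROVED;
spine PROVED 0∕9; rung (B)+1 — the programme's measures remain FINITE-torus statements; NOT the mass gap, NOT Clay.  HONEST DEPENDENCY:
continuum YM on T⁴ ⇐ BetaPertH ∧ nine spine estimates (0∕9 proved); BetaPertH ⇐ (D1) ∧ (D4) ∧ CAP+tail; G-an2-4 gates asym, D1 and NE2∕3∕4.
-/

set_option autoImplicit false

noncomputable section

namespace Summit.QuantumFields.BalabanUV.T4Continuum.NE7b.SupZdCouplingTransferUniqueness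

open Real Filter Topology
open Literature.MathematicalPhysics.QuantumFieldTheory.Balaban1983to89
open B6QGQLower276 (X e blk B mem_B sum_B_const)
open SupZdExponentialSums (summable_kernel_row)

variable {d : ℕ}

/-! ## §1. Block means under a sup bound; differences of solutions -/

/-- A block mean does not exceed a uniform bound: `|w| ≤ s` ⟹ `|(n+1)^{−d}Σ_{q∈B n b}w(q)| ≤ s`. [folklore] -/
theorem blockMean_abs_le_of_forall (n : ℕ) {s : ℝ} (w : X d → ℝ) (hw : ∀ q, |w q| ≤ s) (b : X d) :
    |(((n : ℝ) + 1) ^ d)⁻¹ * ∑ q ∈ B n b, w q| ≤ s := by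
  have hvol : (0 : ℝ) < ((n : ℝ) + 1) ^ d := by positivity
  rw [abs_mul, abs_of_pos (inv_pos.2 hvol), inv_mul_le_iff₀ hvol]
  calc |∑ q ∈ B n b, w q| ≤ ∑ q ∈ B n b, |w q| := Finset.abs_sum_le_sum_abs _ _
    _ ≤ ∑ _q ∈ B n b, s := Finset.sum_le_sum fun q _ => hw q
    _ = ((n : ℝ) + 1) ^ d * s := sum_B_const _ _

/-- **DIFFERENCES OF SOLUTIONS SOLVE THE DIFFERENCE EQUATION** (bounded `u, v`, so the kernel rows converge): if `(H_{V,a′} + K)u = f` and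
`(H_{V,a′} + K)v = f` then `w = u − v` satisfies `(H_{V,a} + K)w = −(a′−a)·(n+1)^{−d}Σ_{B(blk ·)}w` — the coupling difference moved to the
right. [folklore] -/
theorem sub_solves (n : ℕ) (a a' : ℝ) {ε γ Bu Bv : ℝ} (hγ : 0 < γ) (V : X d → ℝ) (K : X d → X d → ℝ)
    (hK : ∀ p q, |K p q| ≤ ε * exp (-(γ * ∑ i, (((p i - q i).natAbs : ℕ) : ℝ)))) (f u v : X d → ℝ)
    (hub : ∀ p, |u p| ≤ Bu) (hvb : ∀ p, |v p| ≤ Bv)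
    (hu : ∀ p, ((n : ℝ) + 1) ^ 2 * ∑ μ', (2 * u p - u (p + e μ') - u (p - e μ'))
        + a' / ((n : ℝ) + 1) ^ d * ∑ q ∈ B n (blk n p), u q + V p * u p + ∑' q : X d, K p q * u q = f p)
    (hv : ∀ p, ((n : ℝ) + 1) ^ 2 * ∑ μ', (2 * v p - v (p + e μ') - v (p - e μ'))
        + a' / ((n : ℝ) + 1) ^ d * ∑ q ∈ B n (blk n p), v q + V p * v p + ∑' q : X d, K p q * v q = f p) (p : X d) :
    ((n : ℝ) + 1) ^ 2 * ∑ μ', (2 * (u p - v p) - (u (p + e μ') - v (p + e μ')) - (u (p - e μ') - v (p - e μ')))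
        + a / ((n : ℝ) + 1) ^ d * ∑ q ∈ B n (blk n p), (u q - v q) + V p * (u p - v p) + ∑' q : X d, K p q * (u q - v q)
      = -(a' - a) * ((((n : ℝ) + 1) ^ d)⁻¹ * ∑ q ∈ B n (blk n p), (u q - v q)) := by
  have hsu : Summable fun q : X d => K p q * u q := summable_kernel_row hγ K hK u hub p
  have hsv : Summable fun q : X d => K p q * v q := summable_kernel_row hγ K hK v hvb p
  have e1 : ∑ μ', (2 * (u p - v p) - (u (p + e μ') - v (p + e μ')) - (u (p - e μ') - v (p - e μ')))
      = ∑ μ', (2 * u p - u (p + e μ') - u (p - e μ')) - ∑ μ', (2 * v p - v (p + e μ') - v (p - e μ')) := by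
    rw [← Finset.sum_sub_distrib]; exact Finset.sum_congr rfl fun μ' _ => by ring
  have e2 : ∑ q ∈ B n (blk n p), (u q - v q) = ∑ q ∈ B n (blk n p), u q - ∑ q ∈ B n (blk n p), v q := Finset.sum_sub_distrib _ _
  have e3 : ∑' q : X d, K p q * (u q - v q) = ∑' q : X d, K p q * u q - ∑' q : X d, K p q * v q := by
    rw [← hsu.tsum_sub hsv]; exact tsum_congr fun q => by ring
  rw [e1, e2, e3, div_eq_mul_inv]
  have h1 := hu p
  have h2 := hv p
  rw [div_eq_mul_inv] at h1 h2
  linear_combination h1 - h2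

/-! ## §2. THE END: uniqueness of bounded solutions at the shifted coupling -/

/-- **HEADLINE — (U) TRANSFERS FROM `a` TO `a′` WHEN `|a′ − a|·C_G < 1`**: for every mesh `n`, couplings `a, a′`, potential `V`, kernel
`|K(p,q)| ≤ εe^{−γ|p−q|₁}`: if at coupling `a` (E) every bounded source `|f| ≤ M_f` has a bounded solution `|v| ≤ C_GM_f` of `(H_{V,a} + K)v = f`
and (U) bounded solutions are unique, and `|a′ − a|·C_G < 1`, then at coupling `a′` bounded solutions are unique — (237)'s clause (U) verbatim at
`a′`. [folklore] -/
theorem uniqueness_transfer (n : ℕ) (a a' : ℝ) {ε γ CG : ℝ} (hγ : 0 < γ) (V : X d → ℝ) (K : X d → X d → ℝ)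
    (hK : ∀ p q, |K p q| ≤ ε * exp (-(γ * ∑ i, (((p i - q i).natAbs : ℕ) : ℝ))))
    (hE : ∀ (f : X d → ℝ) (Mf : ℝ), (∀ p, |f p| ≤ Mf) → ∃ v : X d → ℝ, (∀ p, |v p| ≤ CG * Mf) ∧
        ∀ p, ((n : ℝ) + 1) ^ 2 * ∑ μ', (2 * v p - v (p + e μ') - v (p - e μ'))
          + a / ((n : ℝ) + 1) ^ d * ∑ q ∈ B n (blk n p), v q + V p * v p + ∑' q : X d, K p q * v q = f p)
    (hU : ∀ (f : X d → ℝ) (Mf : ℝ), (∀ p, |f p| ≤ Mf) → ∀ (u v : X d → ℝ) (Bu Bv : ℝ), (∀ p, |u p| ≤ Bu) → (∀ p, |v p| ≤ Bv) →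
        (∀ p, ((n : ℝ) + 1) ^ 2 * ∑ μ', (2 * u p - u (p + e μ') - u (p - e μ'))
          + a / ((n : ℝ) + 1) ^ d * ∑ q ∈ B n (blk n p), u q + V p * u p + ∑' q : X d, K p q * u q = f p) →
        (∀ p, ((n : ℝ) + 1) ^ 2 * ∑ μ', (2 * v p - v (p + e μ') - v (p - e μ'))
          + a / ((n : ℝ) + 1) ^ d * ∑ q ∈ B n (blk n p), v q + V p * v p + ∑' q : X d, K p q * v q = f p) →
        ∀ p, u p = v p)
    (hsmall : |a' - a| * CG < 1) :
    ∀ (f : X d → ℝ) (Mf : ℝ), (∀ p, |f p| ≤ Mf) → ∀ (u v : X d → ℝ) (Bu Bv : ℝ), (∀ p, |u p| ≤ Bu) → (∀ p, |v p| ≤ Bv) →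
        (∀ p, ((n : ℝ) + 1) ^ 2 * ∑ μ', (2 * u p - u (p + e μ') - u (p - e μ'))
          + a' / ((n : ℝ) + 1) ^ d * ∑ q ∈ B n (blk n p), u q + V p * u p + ∑' q : X d, K p q * u q = f p) →
        (∀ p, ((n : ℝ) + 1) ^ 2 * ∑ μ', (2 * v p - v (p + e μ') - v (p - e μ'))
          + a' / ((n : ℝ) + 1) ^ d * ∑ q ∈ B n (blk n p), v q + V p * v p + ∑' q : X d, K p q * v q = f p) →
        ∀ p, u p = v p := by
  classical
  intro f Mf _ u v Bu Bv hub hvb hu hv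
  -- the difference and its sup
  obtain ⟨w, hw⟩ : ∃ w : X d → ℝ, ∀ p, w p = u p - v p := ⟨_, fun _ => rfl⟩
  have hwb : ∀ p, |w p| ≤ Bu + Bv := fun p => by rw [hw]; exact (abs_sub _ _).trans (add_le_add (hub p) (hvb p))
  have hbdd : BddAbove (Set.range fun p : X d => |w p|) := ⟨Bu + Bv, by rintro _ ⟨p, rfl⟩; exact hwb p⟩
  obtain ⟨s, hs⟩ : ∃ s : ℝ, s = ⨆ p : X d, |w p| := ⟨_, rfl⟩
  have hws : ∀ p, |w p| ≤ s := fun p => by rw [hs]; exact le_ciSup hbdd p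
  have hs0 : 0 ≤ s := (abs_nonneg _).trans (hws 0)
  -- `w` solves the `a`-equation with the source `g = −(a′−a)Πw`, `|g| ≤ |a′−a|·s`
  obtain ⟨g, hg⟩ : ∃ g : X d → ℝ, ∀ p, g p = -(a' - a) * ((((n : ℝ) + 1) ^ d)⁻¹ * ∑ q ∈ B n (blk n p), w q) := ⟨_, fun _ => rfl⟩
  have hgb : ∀ p, |g p| ≤ |a' - a| * s := fun p => by
    rw [hg, abs_mul, abs_neg]
    exact mul_le_mul_of_nonneg_left (blockMean_abs_le_of_forall n w hws (blk n p)) (abs_nonneg _)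
  have hweq : ∀ p, ((n : ℝ) + 1) ^ 2 * ∑ μ', (2 * w p - w (p + e μ') - w (p - e μ'))
      + a / ((n : ℝ) + 1) ^ d * ∑ q ∈ B n (blk n p), w q + V p * w p + ∑' q : X d, K p q * w q = g p := by
    intro p
    have h := sub_solves n a a' hγ V K hK f u v hub hvb hu hv p
    simp only [← hw] at h
    rw [hg]
    convert h using 3
  -- (E) + (U) at `a`: `w` is the solution with the `ℓ^∞` bound
  obtain ⟨v', hv'b, hv'⟩ := hE g (|a' - a| * s) hgb
  have hwv' : ∀ p, w p = v' p := hU g _ hgb w v' _ _ hwb hv'b hweq hv'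
  -- contraction of the sup
  have hle : s ≤ CG * (|a' - a| * s) := by
    rw [hs]
    refine ciSup_le fun p => ?_
    rw [← hs, hwv' p]
    exact hv'b p
  have hszero : s = 0 := by
    by_contra hne
    have hpos : 0 < s := lt_of_le_of_ne hs0 (Ne.symm hne)
    have h1 : s * 1 ≤ s * (CG * |a' - a|) := by rw [mul_one, mul_comm s, mul_assoc]; exact hle
    have h2 : 1 ≤ CG * |a' - a| := le_of_mul_le_mul_left h1 hpos
    rw [mul_comm] at h2
    linarith
  intro p
  have h := hws p
  rw [hszero, abs_nonpos_iff, hw] at h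
  exact sub_eq_zero.1 h

/-! ## §3. Toy -/

/-- Toy (`d = 1`, `n = 0`): a block mean of a function bounded by `3` is bounded by `3` (§1). -/
example (w : X 1 → ℝ) (hw : ∀ q, |w q| ≤ 3) (b : X 1) : |((((0 : ℕ) : ℝ) + 1) ^ 1)⁻¹ * ∑ q ∈ B 0 b, w q| ≤ 3 :=
  blockMean_abs_le_of_forall (d := 1) 0 w hw b

end Summit.QuantumFields.BalabanUV.T4Continuum.NE7b.SupZdCouplingTransferUniqueness
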